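import Literature.Barriers.ResolutionOfSingularities.ResidualOrderUnboundedNarrow
import HarnessLib

/-!
# Hauser–Perlega's first example: a 3-dimensional E-permissible centre exists at EVERY step

`Literature/Barriers/ResolutionOfSingularities/ResidualOrderUnboundedUnforced.lean` — a strengthening,
uniform in the step `k`, of conjunct (3) of the narrowed barrier `ResidualOrderUnboundedNarrow`
(`ResidualOrderUnboundedNarrow.lean`: "THE POINT CENTRES ARE A CHOICE FROM THE FIRST BLOW-UP ON", proved
there for the starting polynomial only). Along the WHOLE divergent point blow-up run `Example1.seq` of
Hauser–Perlega's first example (`f = z⁸ + F^k`, characteristic `2`; [cite: HauserPerlega2019, §4 First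
example]) every monomial of every `F^k` has `(x, w)`-degree `≥ 8`: the ideal `P = (z, x, w)` satisfies
Hauser–Perlega's permissibility condition "(1) `f ∈ P^{pᵉ}`" [cite: HauserPerlega2019, §2] at every
stage `k`, i.e. the `3`-dimensional regular subvariety `V(z, x, w) ⊂ 𝔸⁶` lies in the top locus
`{ord f_k ≥ 8}` (the singular locus `Sing(J, b) = {ξ : ord_ξ J ≥ b}` of the pair `((f_k), 8)`) at every
stage. Hence the run never passes through a point at which the closed point is the only regular
closed subvariety of the top locus: its point centres are a CHOICE at every step, not only at the start
("in the examples one could choose at various instances a larger center than a point", "We were not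
able to construct examples with cycles where the choice of point centers is forced"
[cite: HauserPerlega2019, §1 and §3] — here: at ALL instances, for this larger centre).

Proof: the state invariant `Example1.stateShape_seq` (the seven printed shapes (0)–(7) of the cycle,
`ResidualOrderUnboundedExample1Cycle.lean`) bounds the exponents of `x` and `w` in every monomial of the
`k`-th polynomial read in the roles of cycle `0`; the accumulated exchange `y ↔ u` (`Example1.sw`) fixes
the variables `x` and `w`.

Scope (what is NOT proved here): condition "(2) `G ∈ P^d`" of [cite: HauserPerlega2019, §2] (the
residual factor) for `P = (z, x, w)` holds at the states of shape (0) and (6)/(7) but fails at the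
shapes (1)–(5), where other coordinate centres of dimension `2` satisfy (1) and (2) (kill test K4.7 of
the cell `res-hironaka`, job tables; not formalised here); nothing here bears on the existence of
resolutions.
-/

noncomputable section

open MvPolynomial Finset

open scoped BigOperators

namespace Literature.Barriers.ResolutionOfSingularities

open Literature.AlgebraicGeometry.Resolution.Hauser2010

namespace HauserPerlega

namespace Example1

variable {K : Type*} [CommRing K]

/-- **Every state shape bounds the `(x, w)`-degree of every monomial below by `8`** (shapes (0)–(7)
of the first example, with their congruences `ex ≡ 4`, `ew + d ≡ 0 (mod 8)`, …).
[cite: HauserPerlega2019, §4 First example (0)–(7)] -/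
theorem xw_degree_of_stateShape {m i : ℕ} {G : MvPolynomial (Fin 5) K} (h : StateShape m i G) :
    ∀ e ∈ G.support, 8 ≤ e 0 + e 4 := by
  have hd : 2 ≤ dOf m := by unfold dOf; omega
  unfold StateShape at h
  split_ifs at h with h0 h1 h2 h4 h5
  · obtain ⟨ex, ey, eu, ew, hex, hey, heu, hew, hR, hk1, hk2⟩ := h
    intro e he
    have := hR e he
    rw [eq_V_iff] at this
    omega
  · obtain ⟨ex, ew, hex, hex8, hew, hR, hk1, hk2⟩ := h
    intro e he
    have := hR e he
    omega
  · obtain ⟨ex, ew, hex, hew, hR, hk1, hk2⟩ := h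
    intro e he
    have := hR e he
    omega
  · obtain ⟨ex, eu, ev, ew, hex, heu, hev, hew, hR, hk1, hk2⟩ := h
    intro e he
    have := hR e he
    omega
  · obtain ⟨ex, eu, ew, hex, heu, hew, hR, hk1, hk2⟩ := h
    intro e he
    have := hR e he
    omega
  · obtain ⟨ex, ey, eu, ew, hex, hey, heu, hew, hR, hk1, hk2⟩ := h
    intro e he
    have := hR e he
    rw [eq_V_iff] at this
    omega

/-- The accumulated exchange of `y` and `u` fixes `x`. [folklore] -/
private theorem sw_apply_zero (m : ℕ) : sw m 0 = 0 := by
  induction m with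
  | zero => rfl
  | succ m ih =>
    rw [sw_succ, Equiv.Perm.coe_mul, Function.comp_apply, ih]
    exact Equiv.swap_apply_of_ne_of_ne (by decide) (by decide)

/-- The accumulated exchange of `y` and `u` fixes `w`. [folklore] -/
private theorem sw_apply_four (m : ℕ) : sw m 4 = 4 := by
  induction m with
  | zero => rfl
  | succ m ih =>
    rw [sw_succ, Equiv.Perm.coe_mul, Function.comp_apply, ih]
    exact Equiv.swap_apply_of_ne_of_ne (by decide) (by decide)

/-- **Along the whole run every monomial of `F^k` has `(x, w)`-degree `≥ 8`.**
[cite: HauserPerlega2019, §4 First example] -/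
theorem xw_degree_seq [CharP K 2] [Nontrivial K] (k : ℕ) :
    ∀ e ∈ (seq K k).support, 8 ≤ e 0 + e 4 := by
  intro e he
  have hS := xw_degree_of_stateShape (stateShape_seq (K := K) k)
  have hmem : e.mapDomain (sw (pos k).1) ∈ (rename (sw (pos k).1) (seq K k)).support := by
    rw [mem_support_rename_equiv, ← Finsupp.mapDomain_comp, Equiv.symm_comp_self,
      Finsupp.mapDomain_id]
    exact he
  have h8 := hS _ hmem
  have hs0 : (sw (pos k).1).symm 0 = 0 := by
    rw [Equiv.symm_apply_eq]; exact (sw_apply_zero _).symm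
  have hs4 : (sw (pos k).1).symm 4 = 4 := by
    rw [Equiv.symm_apply_eq]; exact (sw_apply_four _).symm
  have h0 : e.mapDomain (sw (pos k).1) 0 = e 0 := by
    rw [Finsupp.mapDomain_equiv_apply, hs0]
  have h4 : e.mapDomain (sw (pos k).1) 4 = e 4 := by
    rw [Finsupp.mapDomain_equiv_apply, hs4]
  rw [h0, h4] at h8
  exact h8

/-- **At EVERY step of Hauser–Perlega's divergent run the `3`-dimensional coordinate centre
`P = (z, x, w)` satisfies the permissibility condition (1) "`f ∈ P^{pᵉ}`"** (`pᵉ = 8`): every monomial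
of `F^k` has `Γ`-degree `≥ 8` for `Γ = {x, w}` — the first conjunct of `IsPermissibleCentre 8 Δ {0, 4}`
for every exceptional set `Δ`; equivalently `V(z, x, w)` lies in the top locus `{ord (z⁸ + F^k) ≥ 8}` at
every stage, so the closed point is never the only regular closed subvariety of that locus along the
run. [cite: HauserPerlega2019, §2 (permissible center (1)) and §4 First example] -/
theorem seq_xw_condition_one [CharP K 2] [Nontrivial K] (k : ℕ) :
    ∀ d ∈ (seq K k).support, 8 ≤ ∑ i ∈ ({0, 4} : Finset (Fin 5)), d i := by
  intro d hd
  rw [Finset.sum_pair (by decide)]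
  exact xw_degree_seq k d hd

end Example1

end HauserPerlega

end Literature.Barriers.ResolutionOfSingularities
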